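import Literature.AlgebraicGeometry.Surfaces.LatticePolarizedK3Fibration
import Literature.AlgebraicGeometry.Surfaces.K3SurfaceProofs
import Literature.AlgebraicGeometry.Surfaces.K3PowersHodgeIffKugaSatakePowers
import Literature.AlgebraicGeometry.Motives.MotivatedPeriodTorsor
import Literature.AlgebraicGeometry.HodgeTheory.HodgeConjecture
import HarnessLib

/-!
# Floccari: Hodge classes on all powers of — and (added 2026-08-26) the Kuga–Satake correspondence of — a K3 surface whose transcendental lattice embeds in `U³ ⊕ ⟨-m⟩` — NAMED FACTS

Layer `Literature/AlgebraicGeometry/Surfaces`.  CITE record for the Hodge-ladder stage-4 scoping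
(run/shared/lean/pub/hodge-director/STAGE4-ABELIAN-MOTIVIC-TYPE.md, row 1 "K3 surfaces: powers"): an
UNCONDITIONAL printed instance of the row-1 target `Summit.HodgeConjecture.CorCM.Stage4.HC_K3Powers`
(Hodge classes on every cartesian power `Sᵏ` are algebraic) for a countable union of four-dimensional
families of K3 surfaces of generic Picard rank `16`.

## Source (read: arXiv text `paper:arxiv-2501.02315`)

S. Floccari, *K3 surfaces associated with varieties of generalized Kummer type*, Geom. Topol. 30 (2026)
1129–1154 (arXiv:2501.02315), §5, Theorem 5.11, verbatim: "Let `S` be a projective K3 surface such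
that there exists an isometric embedding `H²_tr(S, ℚ) ↪ (U^{⊕3} ⊕ ⟨-m⟩) ⊗_ℤ ℚ` for some positive
integer `m`. Then: • the Kuga-Satake correspondence for `S` is algebraic; • the Hodge conjecture holds
for any power of `S`."  (Proof, loc. cit.: by Lemma 5.5 there are `n ≥ 2`, a variety `K` of
`Kumⁿ`-type and a rational Hodge isometry `H²_tr(S, ℚ) ≅ H²_tr(S_K, ℚ)`, algebraic by Buskin /
Huybrechts; then Theorem 5.10 (= Thm. 1.2: for the K3 surface `S_K` of a `Kumⁿ`-variety the
Kuga–Satake correspondence is algebraic and all powers of `S_K` satisfy the statement), which rests on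
O'Grady 2021, Markman 2023, Voisin 2022 and Varesco 2023.)  §1: "The theorem gives countably many new
families of K3 surfaces of general Picard rank `16` for which it is possible to prove (i) and (ii)".
The Kuga–Satake half (i) is named, by rank, in the framework-`B` file
`Motives/KugaSatakeCorrespondenceByRank` of the tree; this file records half (ii) on the REAL carriers
— and, since 2026-08-26 (second record below), ALSO half (i) on the real carriers, in the tree's
surface predicate `HodgeTheory.IsKSCorrespondenceAlgebraicBetti` (file `HodgeTheory/KugaSatakeClassBetti`;
Floccari's Conj. 3.3 in the `H²_tr`-form of Remark 3.4), with the `n = 3` case = Floccari, Compos.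
Math. 160 (2024) [`Floccari2024`], §5.1 Theorem (= Introduction Thm. 3; arXiv:2210.02948, statement 32
of the arXiv text [corpus:paper-arxiv-2210.02948 p0017:L35–L37]), verbatim: "Let `S` be a projective
`K3` surface such that there exists an isometric embedding of `H²_tr(S)` into `Λ_{Kum³}(2) ⊗_ℤ ℚ`.
Then [the Kuga–Satake statement of §5.1] holds for `S`." — `Λ_{Kum³} = U^{⊕3} ⊕ ⟨-8⟩` (loc. cit. §1),
so `Λ_{Kum³}(2) ⊗ ℚ = (U(2)^{⊕3} ⊕ ⟨-16⟩) ⊗ ℚ ≅ (U^{⊕3} ⊕ ⟨-1⟩) ⊗ ℚ` as rational quadratic spaces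
(`U(2)_ℚ ≅ U_ℚ`, `16` a square; Floccari 2026 proof of Cor. 5.13: "`U(k) ⊗_ℤ ℚ ≅ U ⊗_ℤ ℚ` for any
`0 ≠ k ∈ ℚ`"), i.e. the case `m = 1` of Theorem 5.11 (i) [corpus:paper-arxiv-2501.02315 p0018:L33–L36,
proof L41–L45: "by Remark 3.7 and Theorem 5.10 (i), the Kuga-Satake correspondence for `S` is algebraic"].

## Rendering (tree carriers) and faithfulness

* "projective K3 surface": `IsK3Surface S` (file `K3Surface`; smooth projective of dimension `2`,
  `H¹(𝒪) = 0`, nowhere-vanishing holomorphic `2`-form).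
* `H²_tr(S, ℚ)` with its intersection form: the tree's `transcendentalSubspace S ⊂ H²(S(ℂ); ℂ)`
  (`= NS(S)^⊥ = T(S) ⊗ ℂ`, file `LatticePolarizedK3Fibration`) read in a MARKING — a `ℂ`-linear
  `η : H²(S(ℂ); ℂ) ≃ ℂ^{22}` (index set `K3Index`) identifying the integral classes with `ℤ^{22}` and
  the cup product with the K3 lattice form, `a ∪ b = k3Form (η a) (η b) • p`, `p` an integral generator
  of `H⁴(S(ℂ); ℂ)` — the clauses, symbol for symbol, of the tree's named fact
  `Huybrechts_K3_marking_exists` (Huybrechts Ch. 1 Prop. 3.5; so the `∀` over markings below is not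
  vacuous).  Under these clauses `k3Form ∘ η` IS the intersection form (the sign of `p` is forced:
  `Λ_{K3}` has signature `(3, 19)`, not `(19, 3)`), so the RATIONAL coordinate vectors `v ∈ ℚ^{22}`
  whose class `η⁻¹(v)` lies in `transcendentalSubspace S` (`IsTranscendentalCoord S η v`) form exactly
  `H²_tr(S, ℚ)` with the form `k3FormRat` — the tree's rational K3 form of `K3SurfaceProofs`, `k3Form_ratCast` — (`(T(S) ⊗ ℂ) ∩ H²(S, ℚ) = T(S)_ℚ`, `T(S)` being defined over
  `ℤ`).
* "isometric embedding `H²_tr(S, ℚ) ↪ (U^{⊕3} ⊕ ⟨-m⟩) ⊗ ℚ`": a `ℚ`-linear map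
  `ι : ℚ^{22} → ℚ^{7}` (target indexed by `U3mIndex`, Gram matrix `u3mGram m = U ⊕ U ⊕ U ⊕ (-m)`)
  which on `H²_tr(S, ℚ)` preserves the forms (`u3mFormQ m (ι v) (ι w) = k3FormRat v w`) and is injective;
  its values off `H²_tr(S, ℚ)` are immaterial.
* "the Hodge conjecture holds for any power of `S`": for every `k`, the tree's per-variety Hodge
  statement `HodgeTheory.HodgeConjectureFor (k * 2) (Motives.SchemeOver.pow S k)` for the cartesian
  power `Sᵏ = S ×_ℂ ⋯ ×_ℂ S` (`Motives.SchemeOver.pow`, `S⁰ = Spec ℂ`), in the spelling of the stage-4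
  target `HC_K3Powers`.
* "the Kuga-Satake correspondence for `S` is algebraic" (half (i), second record): the tree's property
  `HodgeTheory.IsKSCorrespondenceAlgebraicBetti hS.isSmoothProjective` — Floccari's Conj. 3.3 in the
  `H²_tr`-form of Remark 3.4 on the real carriers (an algebraic cycle on `(A × A) × S` inducing the
  Kuga–Satake class map of `H²_tr(S, ℚ)`, for every presentation and every Kuga–Satake variety `A`; the
  module docstring of `KugaSatakeClassBetti` has the clause-by-clause comparison), exactly the predicate in
  which the tree's record of Theorem 3.5 (`Floccari2026_hodgeClasses_algebraic_K3Powers_iff_kugaSatakePowers`,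
  file `K3PowersHodgeIffKugaSatakePowers`) takes its Kuga–Satake hypothesis.

## What is NOT here

Half (i) in framework `B` (see `KugaSatakeCorrespondenceByRank`; here only the real-carrier predicate);
Theorems 1.1/1.2/5.10 (the associated K3 surface `S_K` of a `Kumⁿ`-variety — recorded in existence form in
`Hyperkaehler/KummerTypeAssociatedK3Surface`); Theorem 3.5 itself (file `K3PowersHodgeIffKugaSatakePowers`,
imported here for the kernel consequence); any proof.

## Content and D-0026 accounting (second record, 2026-08-26, seat `hodge-lit-oqh-2` of the literature-typing layer D-0088(4))

`Floccari2026_kugaSatakeCorrespondence_algebraic_of_K3_of_transcendental_embedding` — Theorem 5.11 (i)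
with the SAME binders as the first record (+1 named fact; a refereed published theorem cited at the line;
`lean search IsKSCorrespondenceAlgebraicBetti` finds the predicate, the Thm. 3.5 record and the summit-side
leaf `KSH_K3_Betti`, no assertion for any class of surfaces).  Kernel: with both records and the Thm. 3.5
record, every Kuga–Satake variety `A` of `H²_tr(S, ℚ)` of such an `S` satisfies the tree's Hodge statement
on all its powers `A^{m+1}` (`hodgeConjectureFor_kugaSatakePowers`); the `m = 1` spelling = Floccari 2024
Introduction Thm. 3 by name (`floccari2024_kum3Lattice`).  HONEST FRAMING: typed ≠ proved; nothing here
asserts the Hodge conjecture beyond the printed theorem's scope.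
-/

noncomputable section

open Literature.AlgebraicTopology.SingularHomology

namespace Literature.AlgebraicGeometry.Surfaces

/-! ### The lattice `U^{⊕3} ⊕ ⟨-m⟩` and rational forms -/

/-- Index set of a basis of `U^{⊕3} ⊕ ⟨-m⟩` (rank `2 + 2 + 2 + 1 = 7`): the three hyperbolic planes as
in `K3Index`, and one more index. [cite: Floccari2026, Thm. 5.11 (§5)] -/
abbrev U3mIndex : Type := (Fin 2 ⊕ (Fin 2 ⊕ Fin 2)) ⊕ Unit

/-- **Gram matrix of `U^{⊕3} ⊕ ⟨-m⟩`**: block-diagonal with three hyperbolic planes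
(`hyperbolicPlaneGram`) and the `1 × 1` block `(-m)`. [cite: Floccari2026, Thm. 5.11 (§5)] -/
def u3mGram (m : ℕ) : Matrix U3mIndex U3mIndex ℤ :=
  Matrix.fromBlocks
    (Matrix.fromBlocks hyperbolicPlaneGram 0 0 (Matrix.fromBlocks hyperbolicPlaneGram 0 0 hyperbolicPlaneGram))
    0 0 (Matrix.of fun _ _ => -(m : ℤ))

/-- The `⟨-m⟩` block. [cite: Floccari2026, Thm. 5.11 (§5)] -/
theorem u3mGram_inr_inr (m : ℕ) (a b : Unit) : u3mGram m (Sum.inr a) (Sum.inr b) = -(m : ℤ) := rfl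

/-- The rational bilinear form `vᵀ (U^{⊕3} ⊕ ⟨-m⟩) w` on `ℚ⁷`. [cite: Floccari2026, Thm. 5.11 (§5)] -/
def u3mFormQ (m : ℕ) (a b : U3mIndex → ℚ) : ℚ :=
  ∑ i, ∑ j, a i * (u3mGram m i j : ℚ) * b j

/-! ### Transcendental rational coordinates in a marking -/

/-- In a marking `η : H²(S(ℂ); ℂ) ≃ ℂ^{22}`, the rational coordinate vector `v ∈ ℚ^{22}` is
**transcendental** if its class `η⁻¹(v)` lies in `T(S) ⊗ ℂ = NS(S)^⊥` (`transcendentalSubspace S`);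
these `v` form `H²_tr(S, ℚ)` read in the marking. [cite: Floccari2026, Thm. 5.11 (§5)]
[cite: Huybrechts2016K3, Ch. 3 Lemma 3.1] -/
def IsTranscendentalCoord (S : Motives.SchemeOver ℂ)
    (η : HodgeTheory.complexBetti S (2 * 1) ≃ₗ[ℂ] (K3Index → ℂ)) (v : K3Index → ℚ) : Prop :=
  η.symm (fun i => (v i : ℂ)) ∈ transcendentalSubspace S

/-- Unfolding lemma. [cite: Floccari2026, Thm. 5.11 (§5)] -/
theorem isTranscendentalCoord_iff (S : Motives.SchemeOver ℂ)
    (η : HodgeTheory.complexBetti S (2 * 1) ≃ₗ[ℂ] (K3Index → ℂ)) (v : K3Index → ℚ) :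
    IsTranscendentalCoord S η v ↔ η.symm (fun i => (v i : ℂ)) ∈ transcendentalSubspace S :=
  Iff.rfl

/-! ### The named fact -/

/-- **Floccari 2026, Theorem 5.11 (ii): if the rational transcendental lattice of a projective K3
surface `S` embeds isometrically into `(U^{⊕3} ⊕ ⟨-m⟩) ⊗ ℚ` for some positive integer `m`, then every
Hodge class on every power `Sᵏ` is algebraic** ("… Then: • the Kuga-Satake correspondence for `S` is
algebraic; • [every Hodge class on] any power of `S` [is algebraic]", full sentence in the module
docstring).  Rendering (module docstring): for `S` with `IsK3Surface S`, every marking `(η, p)` with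
the clauses of `Huybrechts_K3_marking_exists` (`p ≠ 0` an integral generator of `H⁴(S(ℂ); ℂ)`,
integral classes of `H²` `↔ ℤ^{22}` under `η`, `a ∪ b = k3Form (η a) (η b) • p`), and every
`ℚ`-linear `ι : ℚ^{22} → ℚ⁷` which is ISOMETRIC (`u3mFormQ m (ι v) (ι w) = k3FormRat v w`) and INJECTIVE
on the transcendental coordinate vectors (`IsTranscendentalCoord S η`), `0 < m`: for every `k`, the
tree's per-variety Hodge statement holds for the cartesian power `Motives.SchemeOver.pow S k` in
dimension `k * 2` (the body's head symbol).  A THEOREM in print (status: proved; unproved in the tree).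
[cite: Floccari2026, Thm. 5.11 (§5) and Thm. 1.2 / 5.10] [cite: Huybrechts2016K3, Ch. 1 Prop. 3.5] -/
def Floccari2026_hodgeClasses_algebraic_powers_of_K3_of_transcendental_embedding : Prop :=
  ∀ (S : Motives.SchemeOver ℂ), IsK3Surface S →
    ∀ (η : HodgeTheory.complexBetti S (2 * 1) ≃ₗ[ℂ] (K3Index → ℂ)) (p : HodgeTheory.complexBetti S (2 * 2)),
      p ≠ 0 → HodgeTheory.IsIntegralClass p →
      (∀ q : HodgeTheory.complexBetti S (2 * 2), HodgeTheory.IsIntegralClass q → ∃ n : ℤ, q = n • p) →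
      (∀ c : HodgeTheory.complexBetti S (2 * 1),
          HodgeTheory.IsIntegralClass c ↔ ∃ v : K3Index → ℤ, η c = fun i => (v i : ℂ)) →
      (∀ a b : HodgeTheory.complexBetti S (2 * 1),
          cupProduct (rfl : 2 * 1 + 2 * 1 = 2 * 2) a b = k3Form (η a) (η b) • p) →
      ∀ (m : ℕ), 0 < m →
      ∀ (ι : (K3Index → ℚ) →ₗ[ℚ] (U3mIndex → ℚ)),
        (∀ v w : K3Index → ℚ, IsTranscendentalCoord S η v → IsTranscendentalCoord S η w →
            u3mFormQ m (ι v) (ι w) = k3FormRat v w) →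
        (∀ v : K3Index → ℚ, IsTranscendentalCoord S η v → ι v = 0 → v = 0) →
      ∀ k : ℕ, HodgeTheory.HodgeConjectureFor (k * 2) (Motives.SchemeOver.pow S k)

/-- Kernel consequence in the spelling of the stage-4 row-1 target: under the hypotheses of Floccari's
Thm. 5.11 (read in a marking), Hodge classes on `S × S` (`= Motives.SchemeOver.pow S 2`, dimension
`4`) are algebraic. [cite: Floccari2026, Thm. 5.11 (§5)] -/
theorem Floccari2026_hodgeClasses_algebraic_powers_of_K3_of_transcendental_embedding.square
    (h : Floccari2026_hodgeClasses_algebraic_powers_of_K3_of_transcendental_embedding)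
    {S : Motives.SchemeOver ℂ} (hS : IsK3Surface S)
    (η : HodgeTheory.complexBetti S (2 * 1) ≃ₗ[ℂ] (K3Index → ℂ)) (p : HodgeTheory.complexBetti S (2 * 2))
    (hp : p ≠ 0) (hpi : HodgeTheory.IsIntegralClass p)
    (hgen : ∀ q : HodgeTheory.complexBetti S (2 * 2), HodgeTheory.IsIntegralClass q → ∃ n : ℤ, q = n • p)
    (hint : ∀ c : HodgeTheory.complexBetti S (2 * 1),
      HodgeTheory.IsIntegralClass c ↔ ∃ v : K3Index → ℤ, η c = fun i => (v i : ℂ))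
    (hcup : ∀ a b : HodgeTheory.complexBetti S (2 * 1),
      cupProduct (rfl : 2 * 1 + 2 * 1 = 2 * 2) a b = k3Form (η a) (η b) • p)
    {m : ℕ} (hm : 0 < m) (ι : (K3Index → ℚ) →ₗ[ℚ] (U3mIndex → ℚ))
    (hiso : ∀ v w : K3Index → ℚ, IsTranscendentalCoord S η v → IsTranscendentalCoord S η w →
      u3mFormQ m (ι v) (ι w) = k3FormRat v w)
    (hinj : ∀ v : K3Index → ℚ, IsTranscendentalCoord S η v → ι v = 0 → v = 0) :
    HodgeTheory.HodgeConjectureFor 4 (Motives.SchemeOver.pow S 2) :=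
  h S hS η p hp hpi hgen hint hcup m hm ι hiso hinj 2

/-! ### Half (i): the Kuga–Satake correspondence (Theorem 5.11 (i); `n = 3`: Floccari 2024, Introduction Thm. 3) -/

/-- **Floccari 2026, Theorem 5.11 (i): if the rational transcendental lattice of a projective K3 surface
`S` embeds isometrically into `(U^{⊕3} ⊕ ⟨-m⟩) ⊗ ℚ` for some positive integer `m`, then the Kuga–Satake
correspondence for `S` is algebraic** ("Let `S` be a projective K3 surface such that there exists an
isometric embedding `H²_tr(S,ℚ) ↪ (U^{⊕3} ⊕ ⟨-m⟩) ⊗_ℤ ℚ` for some positive integer `m`. Then: • the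
Kuga-Satake correspondence for `S` is algebraic; • …"; the `m = 1` case is Floccari 2024, Introduction
Thm. 3 = §5.1 Theorem, `Λ_{Kum³}(2) ⊗ ℚ ≅ (U^{⊕3} ⊕ ⟨-1⟩) ⊗ ℚ`, module docstring).  Rendering: the
binders of `Floccari2026_hodgeClasses_algebraic_powers_of_K3_of_transcendental_embedding` symbol for symbol
(K3 surface `S`, marking `(η, p)` with the clauses of `Huybrechts_K3_marking_exists`, `0 < m`,
`ι : ℚ^{22} → ℚ⁷` isometric and injective on the transcendental coordinate vectors), conclusion the tree's
property `HodgeTheory.IsKSCorrespondenceAlgebraicBetti hS.isSmoothProjective` (Conj. 3.3 in the `H²_tr`-form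
of Remark 3.4, real carriers).  A THEOREM in print (status: proved; REFEREED: Geom. Topol. 2026, `n = 3`
Compos. Math. 2024; unproved in the tree; printed proof: Lemma 5.5 + Buskin/Huybrechts + Thm. 5.10 (i),
itself from Thm. 5.9 and Voisin 2022 Thm. 4.1 by Remark 3.7).
[cite: Floccari2026, Thm. 5.11 (i) (§5.5) with Thm. 5.10 (i), Thm. 1.2 (i)]
[cite: Floccari2024, Introduction Thm. 3 = §5.1 Theorem (the Kuga–Satake statement for K3 surfaces with H²_tr ↪ Λ_{Kum³}(2) ⊗ ℚ)]
[cite: Huybrechts2016K3, Ch. 1 Prop. 3.5] -/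
def Floccari2026_kugaSatakeCorrespondence_algebraic_of_K3_of_transcendental_embedding : Prop :=
  ∀ (S : Motives.SchemeOver ℂ) (hS : IsK3Surface S),
    ∀ (η : HodgeTheory.complexBetti S (2 * 1) ≃ₗ[ℂ] (K3Index → ℂ)) (p : HodgeTheory.complexBetti S (2 * 2)),
      p ≠ 0 → HodgeTheory.IsIntegralClass p →
      (∀ q : HodgeTheory.complexBetti S (2 * 2), HodgeTheory.IsIntegralClass q → ∃ n : ℤ, q = n • p) →
      (∀ c : HodgeTheory.complexBetti S (2 * 1),
          HodgeTheory.IsIntegralClass c ↔ ∃ v : K3Index → ℤ, η c = fun i => (v i : ℂ)) →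
      (∀ a b : HodgeTheory.complexBetti S (2 * 1),
          cupProduct (rfl : 2 * 1 + 2 * 1 = 2 * 2) a b = k3Form (η a) (η b) • p) →
      ∀ (m : ℕ), 0 < m →
      ∀ (ι : (K3Index → ℚ) →ₗ[ℚ] (U3mIndex → ℚ)),
        (∀ v w : K3Index → ℚ, IsTranscendentalCoord S η v → IsTranscendentalCoord S η w →
            u3mFormQ m (ι v) (ι w) = k3FormRat v w) →
        (∀ v : K3Index → ℚ, IsTranscendentalCoord S η v → ι v = 0 → v = 0) →
      HodgeTheory.IsKSCorrespondenceAlgebraicBetti hS.isSmoothProjective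

namespace Floccari2026_kugaSatakeCorrespondence_algebraic_of_K3_of_transcendental_embedding

/-- **Floccari 2024, Introduction Theorem 3 (= §5.1 Theorem), by name**: the case `m = 1`
(`(U^{⊕3} ⊕ ⟨-1⟩) ⊗ ℚ ≅ Λ_{Kum³}(2) ⊗ ℚ`, module docstring) — a projective K3 surface whose rational
transcendental lattice embeds isometrically into `(U^{⊕3} ⊕ ⟨-1⟩) ⊗ ℚ` has algebraic Kuga–Satake
correspondence. [cite: Floccari2024, Introduction Thm. 3 = §5.1 Theorem] [cite: Floccari2026, Thm. 5.11 (i)] -/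
theorem floccari2024_kum3Lattice
    (h : Floccari2026_kugaSatakeCorrespondence_algebraic_of_K3_of_transcendental_embedding)
    {S : Motives.SchemeOver ℂ} (hS : IsK3Surface S)
    (η : HodgeTheory.complexBetti S (2 * 1) ≃ₗ[ℂ] (K3Index → ℂ)) (p : HodgeTheory.complexBetti S (2 * 2))
    (hp : p ≠ 0) (hpi : HodgeTheory.IsIntegralClass p)
    (hgen : ∀ q : HodgeTheory.complexBetti S (2 * 2), HodgeTheory.IsIntegralClass q → ∃ n : ℤ, q = n • p)
    (hint : ∀ c : HodgeTheory.complexBetti S (2 * 1),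
      HodgeTheory.IsIntegralClass c ↔ ∃ v : K3Index → ℤ, η c = fun i => (v i : ℂ))
    (hcup : ∀ a b : HodgeTheory.complexBetti S (2 * 1),
      cupProduct (rfl : 2 * 1 + 2 * 1 = 2 * 2) a b = k3Form (η a) (η b) • p)
    (ι : (K3Index → ℚ) →ₗ[ℚ] (U3mIndex → ℚ))
    (hiso : ∀ v w : K3Index → ℚ, IsTranscendentalCoord S η v → IsTranscendentalCoord S η w →
      u3mFormQ 1 (ι v) (ι w) = k3FormRat v w)
    (hinj : ∀ v : K3Index → ℚ, IsTranscendentalCoord S η v → ι v = 0 → v = 0) :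
    HodgeTheory.IsKSCorrespondenceAlgebraicBetti hS.isSmoothProjective :=
  h S hS η p hp hpi hgen hint hcup 1 one_pos ι hiso hinj

/-- **Kernel consequence of Theorem 5.11 (i) ∧ (ii) with Theorem 3.5 (direction ⇒):** for a projective K3
surface `S` with `H²_tr(S, ℚ) ↪ (U^{⊕3} ⊕ ⟨-m⟩) ⊗ ℚ` (read in a marking, as in both records), every
Kuga–Satake variety `A` of every presentation of `H²_tr(S, ℚ)` satisfies the tree's Hodge statement on all
its powers `A^{m'+1}` ("the Hodge conjecture holds for `A` and any of its powers" for the Weil fourfolds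
`A` arising this way is Floccari's Thm. 5.12 = Thm. 1.3; here only the formal combination of the three
records is derived). [cite: Floccari2026, Thm. 5.11, Thm. 3.5 (§3.4) and Thm. 5.12] -/
theorem hodgeConjectureFor_kugaSatakePowers
    (h : Floccari2026_kugaSatakeCorrespondence_algebraic_of_K3_of_transcendental_embedding)
    (h2 : Floccari2026_hodgeClasses_algebraic_powers_of_K3_of_transcendental_embedding)
    (h35 : Floccari2026_hodgeClasses_algebraic_K3Powers_iff_kugaSatakePowers)
    {S : Motives.SchemeOver ℂ} (hS : IsK3Surface S)
    (η : HodgeTheory.complexBetti S (2 * 1) ≃ₗ[ℂ] (K3Index → ℂ)) (p : HodgeTheory.complexBetti S (2 * 2))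
    (hp : p ≠ 0) (hpi : HodgeTheory.IsIntegralClass p)
    (hgen : ∀ q : HodgeTheory.complexBetti S (2 * 2), HodgeTheory.IsIntegralClass q → ∃ n : ℤ, q = n • p)
    (hint : ∀ c : HodgeTheory.complexBetti S (2 * 1),
      HodgeTheory.IsIntegralClass c ↔ ∃ v : K3Index → ℤ, η c = fun i => (v i : ℂ))
    (hcup : ∀ a b : HodgeTheory.complexBetti S (2 * 1),
      cupProduct (rfl : 2 * 1 + 2 * 1 = 2 * 2) a b = k3Form (η a) (η b) • p)
    {m : ℕ} (hm : 0 < m) (ι : (K3Index → ℚ) →ₗ[ℚ] (U3mIndex → ℚ))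
    (hiso : ∀ v w : K3Index → ℚ, IsTranscendentalCoord S η v → IsTranscendentalCoord S η w →
      u3mFormQ m (ι v) (ι w) = k3FormRat v w)
    (hinj : ∀ v : K3Index → ℚ, IsTranscendentalCoord S η v → ι v = 0 → v = 0)
    (M : HodgeTheory.HodgeModel 2 S) (hM : M.IsHodgeSymmetric)
    {T : Type} [AddCommGroup T] [Module ℚ T] (H : Motives.HodgeStructure T 2) (P : H.Polarization)
    (hT : H.hodgeNumber 2 0 = 1) (ε : ℤˣ)
    (j : H.Hom (HodgeTheory.bettiTwoHodgeStructure hS.isSmoothProjective M hM))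
    (hj : HodgeTheory.IsTranscendentalPartBetti hS.isSmoothProjective M hM H P ε j)
    (A : Motives.AbelianVariety ℂ) (B : HodgeTheory.HodgeModel A.dim A.X) (hB : B.IsHodgeSymmetric)
    (θ : Motives.bettiCohomology A.X 1 ≃ₗ[ℚ] CliffordAlgebra.even P.quadraticForm)
    (hθ : HodgeTheory.IsKugaSatakeVarietyBetti H P hT A B hB θ) (m' : ℕ) :
    HodgeTheory.HodgeConjectureFor (A.powSucc m').dim (A.powSucc m').X :=
  (h35 hS (h S hS η p hp hpi hgen hint hcup m hm ι hiso hinj)).mp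
    (h2 S hS η p hp hpi hgen hint hcup m hm ι hiso hinj) M hM T H P hT ε j hj A B hB θ hθ m'

end Floccari2026_kugaSatakeCorrespondence_algebraic_of_K3_of_transcendental_embedding

end Literature.AlgebraicGeometry.Surfaces

end
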